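import Summits.BirchSwinnertonDyer.BirchSwinnertonDyer.Theorems.BiquadraticEisensteinDescentEisensteinHeartFlatCMInertBadKPrimeKatzFrameBookkeeping
import Summits.BirchSwinnertonDyer.BirchSwinnertonDyer.Theorems.BiquadraticEisensteinDescentEisensteinHeartFlatCMInertBadKPrimeBranchBadPrimesAllJ
import HarnessLib

set_option linter.dupNamespace false -- `Summit.BirchSwinnertonDyer.BirchSwinnertonDyer.Theorems.…` (summit = sub)
set_option autoImplicit false

/-!
# Crux `EisensteinHeartFlatCMInertBadKPrime` (stmt-BirchSwinnertonDyer-21341), line `hsieh-lambda`, layer 2 (V2):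
# the (R)/ramification bookkeeping of `λ = (ψ ∘ N_{L/K₁}) · ‖·‖_L` for ALL thirteen CM `j`

Route `BiquadraticEisensteinDescent` (cell `pub/bsd-wall`, width seat `bsd-wall-cm-bed-w4`). THEOREMS ONLY (no definition, no named
fact, no `sorry`); supports stmt-BirchSwinnertonDyer-21341 as a helper; nothing about the crux's input or any case of BSD is asserted.

`…KatzFrameBookkeeping` (w1) proves `hlam` / `hramS` / `hramT` of the Katz–Hsieh socket for `λ := ψ.compRelNorm L * normCharacter L`
under `W.j ∈ maximalCMJInvariants` + `IsCMFieldOfJ K₁ W.j` (it uses `Deuring_localEulerFactor_ramified`). Here the hj-FREE twins for every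
CM curve `W/ℚ` (`W.HasCM`, any of the thirteen `j`) and any quadratic `K₁` with `θ² = cmFieldDiscrOfJ W.j`, with Deuring's clause (iii)
for `W` as the binder `hψ`: the proofs are w1's, run on the `ℚ`-isogenous maximal model `W₁` (`…DeuringTransport.exists_maximal_model`)
and transported back along the isogeny (*AEC* VII.7.2 over `ℚ` and over `K₁`; `…BranchBadPrimesAllJ`). Same `S`/`hSmem` conventions as
w1's file (`w ∈ S ↔ ¬ W.HasGoodReductionAt (w ∩ ℤ) ∧ p ∉ w`), so `exists_finset_S`, `hS_of_mem`, `smul_mem_S`, `exists_finset_T`,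
`hD_of_union` are used from there unchanged.

References: [SilvermanATAEC1994] Ch. II Thm. 9.2 (b), Ex. 2.31–2.32; [SilvermanAEC2009] Cor. VII.7.2, Prop. VII.5.4 (a);
[Childress2009] Ch. 4 §5 Lemma 5.3 (a).
-/

noncomputable section

open scoped Classical NumberField Pointwise
open NumberField IsDedekindDomain Module WeierstrassCurve
open Literature.NumberTheory.EllipticCurves Literature.NumberTheory.GaloisRepresentations Literature.NumberTheory.Automorphic
open Literature.NumberTheory.EllipticCurves.Rank1Residual
open Summit.BirchSwinnertonDyer.BirchSwinnertonDyer.Theorems.BiquadraticEisensteinDescentEisensteinHeartFlatCMInertBadKPrimeBranchBadPrimes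
open Summit.BirchSwinnertonDyer.BirchSwinnertonDyer.Theorems.BiquadraticEisensteinDescentEisensteinHeartFlatCMInertBadKPrimeKatzFrameBookkeeping
open Summit.BirchSwinnertonDyer.BirchSwinnertonDyer.Theorems.BiquadraticEisensteinDescentEisensteinHeartFlatCMInertBadKPrimeDeuringTransport
open Summit.BirchSwinnertonDyer.BirchSwinnertonDyer.Theorems.BiquadraticEisensteinDescentEisensteinHeartFlatCMInertBadKPrimeBranchBadPrimesAllJ

namespace Summit.BirchSwinnertonDyer.BirchSwinnertonDyer.Theorems.BiquadraticEisensteinDescentEisensteinHeartFlatCMInertBadKPrimeKatzFrameBookkeepingAllJ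

variable {K₁ L : Type} [Field K₁] [NumberField K₁] [Field L] [NumberField L] [Algebra K₁ L]

/-! ### §1 `E ⊗ K₁` is good above the good rational places — every CM curve -/

/-- **`E_{K₁}` is GOOD at every prime of the CM field above a good rational place — every CM curve** (`W.HasCM`, any order):
w1's `hasGoodReductionAt_baseChange_cmField` on the maximal model `W₁ ∼ W` (good at the same rational places, *AEC* VII.7.2 over `ℚ`),
then `W₁ ⊗ K₁` good at `v ⇒ W ⊗ K₁` good at `v` (VII.7.2 over `K₁`). [cite: SilvermanAEC2009, Cor. VII.7.2]
[cite: SilvermanATAEC1994, Ch. II Ex. 2.31(a), 2.32(a) and Thm. 9.2 (b)] -/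
theorem hasGoodReductionAt_baseChange_cmField_of_hasCM (W : WeierstrassCurve ℚ) [W.IsElliptic] (hCM : W.HasCM)
    (h2 : finrank ℚ K₁ = 2) (hθ : ∃ θ : K₁, θ ^ 2 = (cmFieldDiscrOfJ W.j : K₁)) (v : HeightOneSpectrum (𝓞 K₁))
    (hgood : W.HasGoodReductionAt (v.under (𝓞 ℚ))) : (W.baseChange K₁).HasGoodReductionAt v := by
  obtain ⟨W₁, hE₁, hmin₁, hiso, hj₁, -, -, hK₁⟩ := exists_maximal_model W hCM h2 hθ
  haveI := hE₁
  rw [hasGoodReductionAt_baseChange_iff_of_isIsogenous hiso v]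
  exact hasGoodReductionAt_baseChange_cmField W₁ hj₁ hK₁ v
    ((hiso.hasGoodReductionAt_iff_of_isIsogenous (v.under (𝓞 ℚ))).mp hgood)

/-! ### §2 Ramification of `λ` — every CM curve -/

section Lam

variable [IsGalois K₁ L] {W : WeierstrassCurve ℚ} [W.IsElliptic]

/-- **`λ` is UNRAMIFIED above the good rational places — every CM curve** (Deuring (iii) for `W`; §1; the norm character is
unramified). [cite: SilvermanATAEC1994, Ch. II Thm. 9.2 (b)] -/
theorem isUnramifiedAt_lam_of_good_of_hasCM (hCM : W.HasCM) (h2 : finrank ℚ K₁ = 2)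
    (hθ : ∃ θ : K₁, θ ^ 2 = (cmFieldDiscrOfJ W.j : K₁)) {ψ : HeckeCharacter K₁}
    (hψ : ∀ v : HeightOneSpectrum (𝓞 K₁), ψ.IsUnramifiedAt v ↔ (W.baseChange K₁).HasGoodReductionAt v)
    (w : HeightOneSpectrum (𝓞 L)) (hgood : W.HasGoodReductionAt (w.under (𝓞 ℚ))) :
    (ψ.compRelNorm L * HeckeCharacter.normCharacter L).IsUnramifiedAt w := by
  have hv : (W.baseChange K₁).HasGoodReductionAt (w.under (𝓞 K₁)) :=
    hasGoodReductionAt_baseChange_cmField_of_hasCM W hCM h2 hθ _ (by rw [under_under]; exact hgood)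
  exact (ψ.compRelNorm_isUnramifiedAt ((hψ _).mpr hv)).mul' (HeckeCharacter.isUnramifiedAt_normCharacter' w)

/-- **`λ` is RAMIFIED above the bad rational places — every CM curve**, granted `L/K₁` unramified above the bad primes (binder
`hunr`; at the frame w1's `hunr_of_frame`). [cite: SilvermanATAEC1994, Ch. II Thm. 9.2 (b)] [cite: Childress2009, Ch. 4 §5 Lemma 5.3 (a)] -/
theorem not_isUnramifiedAt_lam_of_bad_of_hasCM (hCM : W.HasCM) (h2 : finrank ℚ K₁ = 2)
    (hθ : ∃ θ : K₁, θ ^ 2 = (cmFieldDiscrOfJ W.j : K₁)) {ψ : HeckeCharacter K₁}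
    (hψ : ∀ v : HeightOneSpectrum (𝓞 K₁), ψ.IsUnramifiedAt v ↔ (W.baseChange K₁).HasGoodReductionAt v)
    (hunr : ∀ (ℓ : ℕ) [Fact ℓ.Prime], ¬ W.HasGoodReductionAtPrime ℓ →
      ∀ v : HeightOneSpectrum (𝓞 K₁), (ℓ : 𝓞 K₁) ∈ v.asIdeal → Algebra.IsUnramifiedIn (𝓞 L) v.asIdeal)
    (w : HeightOneSpectrum (𝓞 L)) (hbad : ¬ W.HasGoodReductionAt (w.under (𝓞 ℚ))) :
    ¬ (ψ.compRelNorm L * HeckeCharacter.normCharacter L).IsUnramifiedAt w := by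
  obtain ⟨hℓ, hℓw⟩ := minFac_absNorm_mem w
  haveI : Fact (Ideal.absNorm w.asIdeal).minFac.Prime := ⟨hℓ⟩
  have hbad' : ¬ W.HasGoodReductionAtPrime (Ideal.absNorm w.asIdeal).minFac := by
    rwa [← hasGoodReductionAt_under_iff W L w hℓw]
  have h := not_isUnramifiedAt_compRelNorm_of_bad_of_hasCM W hCM h2 hθ hψ hunr _ hbad' w hℓw
  exact fun hmul ↦ h ((KatzCM.isUnramifiedAt_mul_iff_of_range (HeckeCharacter.isUnramifiedAt_normCharacter' w)).mp hmul)

/-- **`hlam` — every CM curve**: `λ` is unramified outside `S ∪ {w ∣ p}` (w1's `S`). [cite: SilvermanATAEC1994, Ch. II Thm. 9.2 (b)] -/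
theorem hlam_of_mem_of_hasCM (hCM : W.HasCM) (h2 : finrank ℚ K₁ = 2) (hθ : ∃ θ : K₁, θ ^ 2 = (cmFieldDiscrOfJ W.j : K₁))
    {ψ : HeckeCharacter K₁} (hψ : ∀ v : HeightOneSpectrum (𝓞 K₁), ψ.IsUnramifiedAt v ↔ (W.baseChange K₁).HasGoodReductionAt v)
    (p : ℕ) {S : Finset (HeightOneSpectrum (𝓞 L))}
    (hSmem : ∀ w, w ∈ S ↔ ¬ W.HasGoodReductionAt (w.under (𝓞 ℚ)) ∧ ((p : ℕ) : 𝓞 L) ∉ w.asIdeal) :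
    ∀ w : HeightOneSpectrum (𝓞 L), w ∉ S → ((p : ℕ) : 𝓞 L) ∉ w.asIdeal →
    (ψ.compRelNorm L * HeckeCharacter.normCharacter L).IsUnramifiedAt w := by
  intro w hwS hwp
  by_cases hgood : W.HasGoodReductionAt (w.under (𝓞 ℚ))
  · exact isUnramifiedAt_lam_of_good_of_hasCM hCM h2 hθ hψ w hgood
  · exact absurd ((hSmem w).mpr ⟨hgood, hwp⟩) hwS

/-- **`hramS` — every CM curve**: `λ` is ramified on `S ∪ {w ∣ p}` (`p` a bad prime of `W`), granted `hunr`.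
[cite: SilvermanATAEC1994, Ch. II Thm. 9.2 (b)] [cite: Childress2009, Ch. 4 §5 Lemma 5.3 (a)] -/
theorem hramS_of_mem_of_hasCM (hCM : W.HasCM) (h2 : finrank ℚ K₁ = 2) (hθ : ∃ θ : K₁, θ ^ 2 = (cmFieldDiscrOfJ W.j : K₁))
    {ψ : HeckeCharacter K₁} (hψ : ∀ v : HeightOneSpectrum (𝓞 K₁), ψ.IsUnramifiedAt v ↔ (W.baseChange K₁).HasGoodReductionAt v)
    (p : ℕ) {S : Finset (HeightOneSpectrum (𝓞 L))}
    (hSmem : ∀ w, w ∈ S ↔ ¬ W.HasGoodReductionAt (w.under (𝓞 ℚ)) ∧ ((p : ℕ) : 𝓞 L) ∉ w.asIdeal)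
    [Fact p.Prime] (hpbad : ¬ W.HasGoodReductionAtPrime p)
    (hunr : ∀ (ℓ : ℕ) [Fact ℓ.Prime], ¬ W.HasGoodReductionAtPrime ℓ →
      ∀ v : HeightOneSpectrum (𝓞 K₁), (ℓ : 𝓞 K₁) ∈ v.asIdeal → Algebra.IsUnramifiedIn (𝓞 L) v.asIdeal) :
    ∀ w ∈ S ∪ KatzCM.primesOver L p, ¬ (ψ.compRelNorm L * HeckeCharacter.normCharacter L).IsUnramifiedAt w := by
  intro w hw
  rcases Finset.mem_union.mp hw with hw | hw
  · exact not_isUnramifiedAt_lam_of_bad_of_hasCM hCM h2 hθ hψ hunr w ((hSmem w).mp hw).1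
  · have hpw : ((p : ℕ) : 𝓞 L) ∈ w.asIdeal := KatzCM.mem_primesOver.mp hw
    refine not_isUnramifiedAt_lam_of_bad_of_hasCM hCM h2 hθ hψ hunr w ?_
    rwa [hasGoodReductionAt_under_iff W L w hpw]

/-- **`hramT` — every CM curve**: `λ` is ramified on `Σ_p ∪ T` for any `Σ_p` of places above `p` and any `T ⊆ S`.
[cite: SilvermanATAEC1994, Ch. II Thm. 9.2 (b)] -/
theorem hramT_of_mem_of_hasCM (hCM : W.HasCM) (h2 : finrank ℚ K₁ = 2) (hθ : ∃ θ : K₁, θ ^ 2 = (cmFieldDiscrOfJ W.j : K₁))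
    {ψ : HeckeCharacter K₁} (hψ : ∀ v : HeightOneSpectrum (𝓞 K₁), ψ.IsUnramifiedAt v ↔ (W.baseChange K₁).HasGoodReductionAt v)
    (p : ℕ) {S : Finset (HeightOneSpectrum (𝓞 L))}
    (hSmem : ∀ w, w ∈ S ↔ ¬ W.HasGoodReductionAt (w.under (𝓞 ℚ)) ∧ ((p : ℕ) : 𝓞 L) ∉ w.asIdeal)
    [Fact p.Prime] (hpbad : ¬ W.HasGoodReductionAtPrime p)
    (hunr : ∀ (ℓ : ℕ) [Fact ℓ.Prime], ¬ W.HasGoodReductionAtPrime ℓ →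
      ∀ v : HeightOneSpectrum (𝓞 K₁), (ℓ : 𝓞 K₁) ∈ v.asIdeal → Algebra.IsUnramifiedIn (𝓞 L) v.asIdeal)
    {Sp T : Finset (HeightOneSpectrum (𝓞 L))} (hSp : ∀ w ∈ Sp, ((p : ℕ) : 𝓞 L) ∈ w.asIdeal) (hTS : T ⊆ S) :
    ∀ w ∈ Sp ∪ T, ¬ (ψ.compRelNorm L * HeckeCharacter.normCharacter L).IsUnramifiedAt w := by
  intro w hw
  refine hramS_of_mem_of_hasCM hCM h2 hθ hψ p hSmem hpbad hunr w (Finset.mem_union.mpr ?_)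
  rcases Finset.mem_union.mp hw with hw | hw
  · exact Or.inr (KatzCM.mem_primesOver.mpr (hSp w hw))
  · exact Or.inl (hTS hw)

end Lam

end Summit.BirchSwinnertonDyer.BirchSwinnertonDyer.Theorems.BiquadraticEisensteinDescentEisensteinHeartFlatCMInertBadKPrimeKatzFrameBookkeepingAllJ

end
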